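import Mathlib.GroupTheory.Index
import Mathlib.GroupTheory.Finiteness
import Literature.GroupTheory.CombinatorialGroupTheory.FreeFactorCompletion
import HarnessLib

/-!
# M. Hall's theorem, free-factor form: a finitely generated subgroup of a free group is a free factor of
# a subgroup of finite index

Topic `Literature/GroupTheory/CombinatorialGroupTheory`; completes `FreeGroupSubgroupSeparable.lean`,
which proves M. Hall's theorem (1949) in Burns' form (Lyndon–Schupp, *Combinatorial Group Theory*, Ch. I
Prop. 3.10) WITHOUT its free-factor clause.  Here the clause is proved:

* `exists_finiteIndex_freeFactor` — for a finitely generated subgroup `H` of a free group `G` (Mathlib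
  `IsFreeGroup G`, any rank) there is a subgroup `K ≥ H` of finite index together with free bases `bK`
  of `K` and `bH` of `H` such that `bH` is the restriction of `bK` to a subset of its index type
  ("`Y₁ ⊆ Y` implies that `H` is a free factor of `G`", loc. cit.); the index type of `bK` is finite when
  `G` has finite rank;
* `exists_basis_closure_image` — the subgroup generated by part of a free basis is free on that part;
* (from the completed coset graph of `FreeFactorCompletion.lean`) `treeHom_val_smul` — the tree path to a
  vertex is labelled by an element carrying `x₀` to that coset ("`1 · π(t) = t`"), so the loop of a TRUE
  arrow is labelled by an element of `H` (`loopOfHom_val_mem`); `wordPath` — the true path spelled by a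
  word whose terminal segments keep `x₀` in `X S`, with its label (`WordPath.val_eq`).

Proof (Lyndon–Schupp, proof of Prop. 3.10; in Stallings' language, completing the core of the coset
graph to a finite cover): with the completed action of `FreeFactorCompletion.lean`, `K` is the stabiliser
of the base vertex (finite index: its orbit is finite); by the spanning-tree basis of
`FreeGroupoidTreeBasis.lean` applied to the breadth-first tree of TRUE edges, `K` is free on the loops of
the non-tree edges of the completed graph; the loops of the TRUE non-tree edges lie in `H`
(`loopOfHom_val_mem`) and generate it, because the closed true path spelled by a generator of `H`
telescopes into such loops (`homOfSymmPath_mem_loopSubgroup`) — so `H` is generated by a subset of a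
free basis of `K`.  Classical; no new mathematics. [cite: LyndonSchupp2001, Ch. I Prop. 3.10]
-/

namespace Literature.GroupTheory.CombinatorialGroupTheory

open CategoryTheory Quiver IsFreeGroupoid FreeGroupoidTree Equiv

universe u

noncomputable section

open scoped Classical

/-! ## Part of a free basis generates a free subgroup with that basis -/

/-- The subgroup generated by the images of a SUBSET `s` of a free basis `bK` of `K ≤ G` is free on `s`,
with basis vectors the given ones (the inclusion `FreeGroup s → FreeGroup κ` is injective).
[cite: LyndonSchupp2001, Ch. I Prop. 3.10] -/
theorem exists_basis_closure_image {G : Type*} [Group G] {K : Subgroup G} {κ : Type*}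
    (bK : FreeGroupBasis κ K) (s : Set κ) (H : Subgroup G)
    (hH : H = Subgroup.closure ((fun i : κ => (bK i : G)) '' s)) :
    ∃ bH : FreeGroupBasis s H, ∀ i : s, (bH i : G) = (bK i : G) := by
  classical
  let φ : FreeGroup s →* G := FreeGroup.lift fun i : s => (bK (i : κ) : G)
  have hφ : φ = (K.subtype.comp bK.repr.symm.toMonoidHom).comp (FreeGroup.map fun i : s => (i : κ)) := by
    ext i
    simp only [φ, FreeGroup.lift_apply_of, MonoidHom.coe_comp, Function.comp_apply, FreeGroup.map.of,
      Subgroup.coe_subtype]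
    rfl
  have hinj : Function.Injective φ := by
    rw [hφ]
    exact (K.subtype_injective.comp bK.repr.symm.injective).comp
      (FreeGroup.map_injective Subtype.val_injective)
  have hrange : φ.range = H := by
    rw [hH, FreeGroup.range_lift_eq_closure, Set.image_eq_range (fun i : κ => (bK i : G)) s]
  let e : FreeGroup s ≃* H := (MonoidHom.ofInjective hinj).trans (MulEquiv.subgroupCongr hrange)
  refine ⟨FreeGroupBasis.ofRepr e.symm, fun i => ?_⟩
  change ((e (FreeGroup.of i) : H) : G) = _
  change ((MonoidHom.ofInjective hinj (FreeGroup.of i) : φ.range) : G) = _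
  rw [MonoidHom.ofInjective_apply]
  exact FreeGroup.lift_apply_of

namespace FreeFactor

/- As in Mathlib's `NielsenSchreier.lean`: type synonyms for the objects of the groupoid must be unfolded
by unification. -/
set_option backward.isDefEq.respectTransparency false

variable {G : Type u} [Group G] [IsFreeGroup G] (S : Finset G)

/-! ## Labels of tree paths and loops -/

/-- The morphism along a tree path from the base object is labelled by an element of `G` carrying the
base coset `x₀` to the coset of the endpoint ("`1 · π(t) = t`", loc. cit.).
[cite: LyndonSchupp2001, Ch. I Prop. 3.10] -/
theorem homOfPath_val_smul : ∀ {a : Cov S} (p : Path (root (tree S)) a),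
    (FreeGroupoidTree.homOfPath (tree S) p).val • x₀ S = (ActionCategory.back a : V S).1
  | _, Path.nil => by
    change (1 : G) • x₀ S = (v₀ S).1
    rw [one_smul]; rfl
  | _, Path.cons (b := b) (c := c) p ⟨Sum.inl e, he⟩ => by
    have ih := homOfPath_val_smul p
    have ht : IsTrue S e := isTrue_of_mem_tree S he
    change ((FreeGroupoidTree.homOfPath (tree S) p ≫ IsFreeGroupoid.of e).val) • x₀ S = _
    rw [comp_val, mul_smul, ih]
    exact ht
  | _, Path.cons (b := b) (c := c) p ⟨Sum.inr e, he⟩ => by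
    have ih := homOfPath_val_smul p
    have ht : IsTrue S e := isTrue_of_mem_tree S he
    change ((FreeGroupoidTree.homOfPath (tree S) p ≫ CategoryTheory.inv (IsFreeGroupoid.of e)).val) •
      x₀ S = _
    rw [comp_val, inv_val, mul_smul, ih, inv_smul_eq_iff]
    exact ht.symm

/-- The tree morphism to `a` is labelled by an element carrying `x₀` to the coset of `a`.
[cite: LyndonSchupp2001, Ch. I Prop. 3.10] -/
theorem treeHom_val_smul (a : Cov S) :
    (treeHom (tree S) a).val • x₀ S = (ActionCategory.back a : V S).1 :=
  homOfPath_val_smul S default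

/-- The loop of a TRUE generating arrow is labelled by an element of `H` (it carries `x₀` back to `x₀`).
[cite: LyndonSchupp2001, Ch. I Prop. 3.10] -/
theorem loopOfHom_val_mem {a b : Generators (Cov S)} (e : a ⟶ b) (he : IsTrue S e) :
    (loopOfHom (tree S) (IsFreeGroupoid.of e)).val ∈ Hgen S := by
  rw [← smul_x₀_eq_iff]
  change (treeHom (tree S) a ≫ IsFreeGroupoid.of e ≫ CategoryTheory.inv (treeHom (tree S) b)).val •
    x₀ S = x₀ S
  rw [comp_val, comp_val, inv_val, mul_smul, mul_smul,
    treeHom_val_smul, inv_smul_eq_iff, treeHom_val_smul]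
  exact he

/-! ## The closed path spelled by a word -/

/-- The true path from the base object spelled by a word `L` all of whose terminal segments keep `x₀`
inside `X`: its endpoint, the path, the fact that all its arrows are true, and its label `wordProd L`.
[cite: LyndonSchupp2001, Ch. I Prop. 3.10] -/
structure WordPath (L : List (Letter G × Bool)) : Type u where
  /-- the endpoint -/
  stop : V S
  /-- the endpoint is the coset `L · x₀` -/
  stop_eq : stop.1 = wordProd L • x₀ S
  /-- the path in the symmetrised generating quiver -/
  path : Path (rootVtx (tree S)) (show Symmetrify (Generators (Cov S)) from vtx S stop)
  /-- all its arrows are true -/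
  forall_true : PathForall (tree S) (IsTrue S) path
  /-- its label is the element spelled by `L` -/
  val_eq : (homOfSymmPath (tree S) path).val = wordProd L

/-- Construction of the word path, by induction on the word ("if `t = y₁ ⋯ yₙ` we have inductively that
`1 · π(t) = t`", loc. cit.). [cite: LyndonSchupp2001, Ch. I Prop. 3.10] -/
def wordPath : ∀ (L : List (Letter G × Bool)) (_ : ∀ s, s <:+ L → wordProd s • x₀ S ∈ X S),
    WordPath S L
  | [], _ =>
    { stop := v₀ S
      stop_eq := by rw [v₀_val, wordProd_nil, one_smul]
      path := Path.nil
      forall_true := trivial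
      val_eq := by rw [wordProd_nil]; rfl }
  | (a, true) :: L, hL =>
    let W := wordPath L fun s hs => hL s (hs.trans (List.suffix_cons _ _))
    have hmem : IsFreeGroup.of a • W.stop.1 ∈ X S := by
      rw [W.stop_eq, ← mul_smul, ← wordProd_cons_true]; exact hL _ (List.suffix_refl _)
    have hstep : IsFreeGroup.of a • W.stop = mkV S _ hmem := by
      rw [of_smul, σ_apply S a _ hmem]
    { stop := mkV S _ hmem
      stop_eq := by
        rw [mkV_val, W.stop_eq, ← mul_smul, ← wordProd_cons_true]
      path := W.path.cons (Sum.inl ⟨a, hstep⟩)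
      forall_true := ⟨W.forall_true, rfl⟩
      val_eq := by
        rw [homOfSymmPath_cons, comp_val, W.val_eq, wordProd_cons_true]
        rfl }
  | (a, false) :: L, hL =>
    let W := wordPath L fun s hs => hL s (hs.trans (List.suffix_cons _ _))
    have hmem : (IsFreeGroup.of a)⁻¹ • W.stop.1 ∈ X S := by
      rw [W.stop_eq, ← mul_smul, ← wordProd_cons_false]; exact hL _ (List.suffix_refl _)
    have hstep : IsFreeGroup.of a • mkV S _ hmem = W.stop := by
      rw [of_smul, σ_apply_inv_smul S a _ hmem]
    let arrow : (show Generators (Cov S) from vtx S (mkV S _ hmem)) ⟶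
        (show Generators (Cov S) from vtx S W.stop) := ⟨a, hstep⟩
    have hval : (CategoryTheory.inv (IsFreeGroupoid.of arrow)).val = (IsFreeGroup.of a)⁻¹ := by
      rw [inv_val]; rfl
    { stop := mkV S _ hmem
      stop_eq := by
        rw [mkV_val, W.stop_eq, ← mul_smul, ← wordProd_cons_false]
      path := W.path.cons (Sum.inr arrow)
      forall_true := ⟨W.forall_true, by
        change IsFreeGroup.of a • (mkV S _ hmem).1 = W.stop.1
        rw [mkV_val, smul_inv_smul]⟩
      val_eq := by
        rw [homOfSymmPath_cons, comp_val, W.val_eq, wordProd_cons_false]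
        change (CategoryTheory.inv (IsFreeGroupoid.of arrow)).val * wordProd L = _
        rw [hval] }


/-! ## The completed subgroup `K` and its Schreier basis -/

/-- The completed subgroup `K`: the stabiliser of the base vertex in the completed action (Lyndon–Schupp's
`G`, "the group generated by all `γ(w)`"). [cite: LyndonSchupp2001, Ch. I Prop. 3.10] -/
def K : Subgroup G := MulAction.stabilizer G (v₀ S)

omit [IsFreeGroup G] in
/-- Membership in `K`. [cite: LyndonSchupp2001, Ch. I Prop. 3.10] -/
theorem mem_K_iff [IsFreeGroup G] (g : G) : g ∈ K S ↔ g • v₀ S = v₀ S := MulAction.mem_stabilizer_iff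

/-- `K` has finite index: the orbit of the base vertex is finite ("since `T` is a transversal of `G` and
`T` is finite, `G` has finite index"). [cite: LyndonSchupp2001, Ch. I Prop. 3.10] -/
instance K_finiteIndex : (K S).FiniteIndex := by
  haveI : Finite (G ⧸ K S) :=
    Finite.of_equiv _ (MulAction.orbitEquivQuotientStabilizer G (v₀ S))
  exact Subgroup.finiteIndex_of_finite_quotient

/-- The vertex group of the covering groupoid at the base object IS the stabiliser `K` (same elements).
[cite: LyndonSchupp2001, Ch. I Prop. 3.10] -/
def endEquiv : End (rootObj (tree S)) ≃* K S where
  toFun f := ⟨f.val, f.property⟩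
  invFun g := ⟨g.val, g.property⟩
  left_inv _ := rfl
  right_inv _ := rfl
  map_mul' _ _ := rfl

/-- `endEquiv` preserves the underlying element of `G`. [cite: LyndonSchupp2001, Ch. I Prop. 3.10] -/
@[simp] theorem coe_endEquiv (f : End (rootObj (tree S))) : (endEquiv S f : G) = f.val := rfl

/-- The Schreier basis of `K`: the loops of the non-tree generating arrows of the completed covering
graph ("the basis `Y` for `G`"). [cite: LyndonSchupp2001, Ch. I Prop. 3.10] -/
def basisK : FreeGroupBasis (LoopIndex (tree S)) (K S) :=
  (treeBasis (tree S)).map (endEquiv S)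

/-- The basis vector of `K` at a non-tree arrow is the label of its loop. [cite: LyndonSchupp2001, Ch. I Prop. 3.10] -/
theorem basisK_apply (e : LoopIndex (tree S)) :
    (basisK S e : G) = (loopOfHom (tree S) (IsFreeGroupoid.of e.val.hom)).val := by
  rw [basisK, FreeGroupBasis.map_apply, treeBasis_apply]; rfl

/-- The sub-basis: the loops of the TRUE non-tree arrows ("the basis `Y₁` for `H`", `Y₁ ⊆ Y`).
[cite: LyndonSchupp2001, Ch. I Prop. 3.10] -/
def trueIndex : Set (LoopIndex (tree S)) :=
  {e | IsTrue S e.val.hom}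

/-! ## `H ≤ K`, and `H` is generated by the sub-basis -/

/-- `H ≤ K`: every generator of `H` fixes the base vertex in the completed action, because the path it
spells consists of true edges. [cite: LyndonSchupp2001, Ch. I Prop. 3.10] -/
theorem Hgen_le_K : Hgen S ≤ K S := by
  rw [Subgroup.closure_le]
  intro w hw
  rw [SetLike.mem_coe, mem_K_iff]
  obtain ⟨stop, stop_eq, path, -, hval⟩ := wordPath S (word w) fun s hs => suffix_mem S hw hs
  have h1 : (homOfSymmPath (tree S) path).val • v₀ S = stop := (homOfSymmPath (tree S) path).property
  have h2 : stop = v₀ S :=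
    V.ext S (by rw [stop_eq, v₀_val, wordProd_word, smul_x₀_eq_iff]; exact Subgroup.subset_closure hw)
  rw [hval, wordProd_word] at h1
  rw [h1, h2]

/-- The sub-basis vectors lie in `H`. [cite: LyndonSchupp2001, Ch. I Prop. 3.10] -/
theorem basisK_mem_of_true (e : LoopIndex (tree S)) (he : e ∈ trueIndex S) :
    (basisK S e : G) ∈ Hgen S := by
  rw [basisK_apply]
  exact loopOfHom_val_mem S _ he

/-- The labels of the loops of ALL true arrows lie in the subgroup generated by the sub-basis vectors (a
true tree arrow has trivial loop). [cite: LyndonSchupp2001, Ch. I Prop. 3.10] -/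
theorem map_loopSubgroup_le :
    (loopSubgroup (tree S) (IsTrue S)).map ((K S).subtype.comp (endEquiv S).toMonoidHom) ≤
      Subgroup.closure ((fun e => (basisK S e : G)) '' trueIndex S) := by
  rw [loopSubgroup, MonoidHom.map_closure, Subgroup.closure_le]
  rintro _ ⟨x, ⟨a, b, e, he, rfl⟩, rfl⟩
  by_cases ht : (⟨a, b, e⟩ : Total (Generators (Cov S))) ∈ treeArrows (tree S)
  · have h1 : loopOfHom (tree S) (IsFreeGroupoid.of e) = 1 := loopOfHom_eq_one (tree S) e ht
    rw [h1, map_one]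
    exact one_mem _
  · apply Subgroup.subset_closure
    exact ⟨⟨⟨a, b, e⟩, ht⟩, he, basisK_apply S ⟨⟨a, b, e⟩, ht⟩⟩

/-- `H` is contained in the subgroup generated by the sub-basis vectors: the closed true path spelled by a
generator of `H` telescopes into loops of true arrows. [cite: LyndonSchupp2001, Ch. I Prop. 3.10] -/
theorem Hgen_le_closure :
    Hgen S ≤ Subgroup.closure ((fun e => (basisK S e : G)) '' trueIndex S) := by
  rw [Subgroup.closure_le]
  intro w hw
  obtain ⟨stop, stop_eq, path, htrue, hval⟩ := wordPath S (word w) fun s hs => suffix_mem S hw hs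
  have hstop : stop = v₀ S :=
    V.ext S (by rw [stop_eq, v₀_val, wordProd_word, smul_x₀_eq_iff]; exact Subgroup.subset_closure hw)
  subst hstop
  have hmem := homOfSymmPath_mem_loopSubgroup (tree S) (IsTrue S) path htrue
  have h2 := map_loopSubgroup_le S (Subgroup.mem_map_of_mem
    ((K S).subtype.comp (endEquiv S).toMonoidHom) hmem)
  have hv : ((K S).subtype.comp (endEquiv S).toMonoidHom) (homOfSymmPath (tree S) path) = w := by
    change (homOfSymmPath (tree S) path).val = w
    rw [hval, wordProd_word]
  rw [hv] at h2
  exact h2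

/-- `H` is exactly the subgroup generated by the sub-basis vectors.
[cite: LyndonSchupp2001, Ch. I Prop. 3.10] -/
theorem Hgen_eq_closure : Hgen S = Subgroup.closure ((fun e => (basisK S e : G)) '' trueIndex S) :=
  le_antisymm (Hgen_le_closure S) (by
    rw [Subgroup.closure_le]
    rintro _ ⟨e, he, rfl⟩
    exact basisK_mem_of_true S e he)

/-! ## Finiteness of the index types -/

/-- The completed covering graph has finitely many generating arrows when the alphabet is finite.
[cite: LyndonSchupp2001, Ch. I Prop. 3.10] -/
theorem finite_total [Finite (Letter G)] : Finite (Total (Generators (Cov S))) := by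
  refine Finite.of_injective (fun t : Total (Generators (Cov S)) =>
    ((ActionCategory.back t.left : V S), (ActionCategory.back t.right : V S), t.hom.1)) ?_
  rintro ⟨a, b, e⟩ ⟨a', b', e'⟩ h
  simp only [Prod.mk.injEq] at h
  obtain ⟨ha, hb, he⟩ := h
  have ha' : a = a' := congrArg (vtx S) ha
  have hb' : b = b' := congrArg (vtx S) hb
  subst ha' hb'
  have he' : e = e' := Subtype.ext he
  subst he'
  rfl

/-! ## The theorem -/

/-- **M. Hall's theorem, free-factor form** (Hall 1949; Burns 1969; Lyndon–Schupp Ch. I Prop. 3.10: "`H`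
is a free factor of a group `G`, of finite index in `F`"): a finitely generated subgroup `H` of a free
group `G` lies in a subgroup `K` of finite index admitting a free basis `bK`, indexed by `s ⊕ sᶜ` for a
subset `s` of some type `κ`, whose `s`-part is a free basis `bH` of `H`; `κ` is finite if `G` has finite
rank. [cite: LyndonSchupp2001, Ch. I Prop. 3.10] -/
theorem exists_finiteIndex_freeFactor {G : Type u} [Group G] [IsFreeGroup G] (H : Subgroup G)
    (hH : H.FG) :
    ∃ K : Subgroup G, K.FiniteIndex ∧ H ≤ K ∧
      ∃ (κ : Type u) (s : Set κ) (bK : FreeGroupBasis (↥s ⊕ ↥sᶜ) K) (bH : FreeGroupBasis s H),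
        (Finite (IsFreeGroup.Generators G) → Finite κ) ∧
        ∀ i : s, (bH i : G) = (bK (Sum.inl i) : G) := by
  obtain ⟨S, hS⟩ := hH
  subst hS
  obtain ⟨bH, hbH⟩ :=
    exists_basis_closure_image (basisK S) (trueIndex S) (Hgen S) (Hgen_eq_closure S)
  refine ⟨K S, inferInstance, Hgen_le_K S, LoopIndex (tree S), trueIndex S,
    (basisK S).reindex (Equiv.Set.sumCompl (trueIndex S)).symm, bH, ?_, fun i => ?_⟩
  · intro hfin
    haveI := hfin
    haveI := finite_total S
    infer_instance
  · rw [hbH, FreeGroupBasis.reindex_apply, Equiv.symm_symm, Equiv.Set.sumCompl_apply_inl]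

end FreeFactor

end

end Literature.GroupTheory.CombinatorialGroupTheory
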